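import Literature.AlgebraicGeometry.Motives.FamiliesVHS
import HarnessLib

/-!
# Pull-back of the data of a polarized variation of Hodge structure along a continuous map, and descent of the
# «everything-or-finite» dichotomy of the Hodge locus along a surjection (the «finite étale covering» step of
# Cattani–Deligne–Kaplan's proof of Theorem 1.1)

Topic `Literature/AlgebraicGeometry/Motives` (namespace `Literature.AlgebraicGeometry.Motives.VHSData`), lane `lit-hodgefound` (seat `p08`, row
g55-#5).  ONE DEFINITION (`VHSData.comap`, a `structure` instance built from the tree's `LocalSystem.comap`; no named fact, no `instance`, no
notation; D-0026 net debt `0`) and its API.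

PRINTED SOURCES, VERBATIM.  P. Griffiths, *Periods of integrals on algebraic manifolds III*, Publ. Math. IHÉS 38 (1970), §1 / W. Schmid,
*Variation of Hodge structure: the singularities of the period mapping*, Invent. Math. 22 (1973), §2: a (polarized) variation of Hodge structure
is a flat bundle with pointwise Hodge structures and a flat polarization form — data which PULL BACK along any holomorphic (here: continuous)
map of the base, the local system by precomposition with `Π₁(f)` (P. Deligne, *Équations différentielles à points singuliers réguliers*, LNM 163
(1970), I.1: inverse image of a local system).  E. Cattani, P. Deligne, A. Kaplan, *On the locus of Hodge classes*, J. AMS 8 (1995), «Proof of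
1.5 ⟹ 1.1» (p. 485; held text `paper:arxiv-alg-geom_9402009` p0002): «To prove 1.1 one is free to replace `S` of 1.1 by a finite etale covering
`S' → S`. We may and shall assume that the monodromy mod `k` of `𝒱` is trivial, for some `k ≥ 3`. … The assumption on the monodromy ensures
that the local monodromy of `𝒱` at infinity is unipotent».

* §1 **`VHSData.comap`** — the pull-back `f* D : VHSData S' n` of `D : VHSData S n` along `f : C(S', S)`: local systems `V_ℤ ∘ Π₁(f)`,
  `V ∘ Π₁(f)` (`LocalSystem.comap`), the SAME comparison `ratIso` whiskered, the Hodge structure and polarization of the fibre `V_{f s'}`, flatness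
  of the forms along image paths; fibres, `toRat`, transport and `IsHodgeAt` of `f* D` are those of `D` at `f s'` (`rfl` lemmas).
* §2 **`hodgeLocusOfNormLe_comap`** — `Hdg-locus_{≤ K}(f* D) = f⁻¹(Hdg-locus_{≤ K}(D))`; likewise the determination locus pulls back INTO the
  pull-back of the determination locus (equality needs path lifting, not here).
* §3 **`hodgeLocusOfNormLe_eq_univ_or_finite_of_comap`** — DESCENT along a SURJECTIVE `f` («one is free to replace `S` by a finite etale covering
  `S' → S`»): if the Hodge locus of norm `≤ K` of `f* D` is all of `S'` or finite, then that of `D` is all of `S` or finite; and the converse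
  pull-back statement for `f` with finite fibres.

NOT HERE: existence of a finite étale cover killing the monodromy mod `k` (and `k ≥ 3 ⟹` unipotent local monodromy: the tree's
`GroupTheory/ArithmeticGroups/NeatQuasiUnipotent`), path lifting for covering maps (equality of determination loci), holomorphy.

## References

* [Griffiths1970] P. Griffiths, *Periods of integrals on algebraic manifolds III*, Publ. Math. IHÉS 38 (1970), §1.
* [Schmid1973] W. Schmid, *Variation of Hodge structure: the singularities of the period mapping*, Invent. Math. 22 (1973), §2.
* [Deligne1970] P. Deligne, *Équations différentielles à points singuliers réguliers*, LNM 163 (1970), I.1.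
* [CattaniDeligneKaplan1995] E. Cattani, P. Deligne, A. Kaplan, *On the locus of Hodge classes*, J. Amer. Math. Soc. 8 (1995) 483–506: «Proof of
  1.5 ⟹ 1.1» (p. 485).
-/

noncomputable section

open CategoryTheory Set

namespace Literature.AlgebraicGeometry.Motives

namespace VHSData

variable {S : Type} [TopologicalSpace S] {S' : Type} [TopologicalSpace S'] {S'' : Type} [TopologicalSpace S''] {n : ℤ}
variable (D : VHSData S n) (f : C(S', S))

/-! ## §1 The pull-back `f* D` -/

/-- **Pull-back of VHS data along a continuous map** `f : S' → S` (Griffiths 1970 §1 / Schmid 1973 §2: the flat bundle, the pointwise Hodge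
structures and the flat polarization all pull back; Deligne 1970 I.1: inverse image of a local system = precomposition with `Π₁(f)`).  The
integral and rational local systems are `D.VZ.comap f`, `D.V.comap f` (fibre at `s'` = fibre of `D` at `f s'`, transport along `γ` = transport of
`D` along `f ∘ γ`), the comparison `V ≅ V_ℤ ⊗ ℚ` is `D.ratIso` whiskered by `Π₁(f)`, the Hodge structure and polarization at `s'` are those of `D`
at `f s'`, and the forms are flat because they are flat for `D` along the image paths. [cite: Schmid1973, §2] [cite: Deligne1970, I.1] -/
def comap : VHSData S' n where
  VZ := D.VZ.comap f
  V := D.V.comap f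
  ratIso := Functor.isoWhiskerLeft (FundamentalGroupoid.map f) D.ratIso
  hodge s' := D.hodge (f s')
  form s' := D.form (f s')
  transport_form s' t' γ x y := by
    rw [LocalSystem.comap_transport]
    exact D.transport_form (f s') (f t') (γ.map f) x y
  finite_free s' := D.finite_free (f s')

/-- The integral local system of `f* D` is `f* V_ℤ`. [cite: Deligne1970, I.1] -/
@[simp] theorem comap_VZ : (D.comap f).VZ = D.VZ.comap f := rfl

/-- The rational local system of `f* D` is `f* V`. [cite: Deligne1970, I.1] -/
@[simp] theorem comap_V : (D.comap f).V = D.V.comap f := rfl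

/-- The rational fibre of `f* D` at `s'` IS the fibre of `D` at `f s'`. [cite: Deligne1970, I.1] -/
theorem comap_V_fiber (s' : S') : (D.comap f).V.fiber s' = D.V.fiber (f s') := rfl

/-- The integral fibre of `f* D` at `s'` IS the fibre of `D` at `f s'`. [cite: Deligne1970, I.1] -/
theorem comap_VZ_fiber (s' : S') : (D.comap f).VZ.fiber s' = D.VZ.fiber (f s') := rfl

/-- The Hodge structure of `f* D` at `s'` is that of `D` at `f s'`. [cite: Schmid1973, §2] -/
@[simp] theorem comap_hodge (s' : S') : (D.comap f).hodge s' = D.hodge (f s') := rfl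

/-- The polarization of `f* D` at `s'` is that of `D` at `f s'`. [cite: Schmid1973, §2] -/
@[simp] theorem comap_form (s' : S') : (D.comap f).form s' = D.form (f s') := rfl

/-- Rational transport of `f* D` along `γ` is transport of `D` along `f ∘ γ`. [cite: Deligne1970, I.1] -/
theorem comap_V_transport {s' t' : S'} (γ : Path.Homotopic.Quotient s' t') :
    (D.comap f).V.transport γ = D.V.transport (γ.map f) := rfl

/-- Integral transport of `f* D` along `γ` is transport of `D` along `f ∘ γ`. [cite: Deligne1970, I.1] -/
theorem comap_VZ_transport {s' t' : S'} (γ : Path.Homotopic.Quotient s' t') :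
    (D.comap f).VZ.transport γ = D.VZ.transport (γ.map f) := rfl

/-- `1 ⊗ u` in `f* D` is `1 ⊗ u` in `D`. [cite: Schmid1973, §2] -/
theorem comap_oneTmul (s' : S') (u : D.VZ.fiber (f s')) : (D.comap f).oneTmul s' u = D.oneTmul (f s') u := rfl

/-- **The comparison map `V_ℤ → V` of `f* D` at `s'` is that of `D` at `f s'`** (the whiskered `ratIso` has the same components).
[cite: Schmid1973, §2] -/
@[simp] theorem comap_toRat (s' : S') : (D.comap f).toRat s' = D.toRat (f s') := by
  ext u
  rfl

/-- **Hodge classes pull back pointwise**: `u` is a Hodge class of level `p` for `f* D` at `s'` iff it is one for `D` at `f s'`.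
[cite: Schmid1973, §2] -/
@[simp] theorem isHodgeAt_comap_iff (s' : S') (p : ℤ) (u : D.VZ.fiber (f s')) :
    (D.comap f).IsHodgeAt s' p u ↔ D.IsHodgeAt (f s') p u := by
  rw [IsHodgeAt, IsHodgeAt, comap_toRat]
  rfl

/-- Pull-back along the identity is the identity on all the pointwise data (fibres, Hodge structures, forms, `toRat`); stated for `toRat`.
[cite: Deligne1970, I.1] -/
theorem comap_id_toRat (s : S) : (D.comap (ContinuousMap.id S)).toRat s = D.toRat s := comap_toRat D _ s

/-- Pull-back is transitive on the pointwise data: `(g* f* D).toRat s'' = D.toRat (f (g s''))`. [cite: Deligne1970, I.1] -/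
theorem comap_comap_toRat (g : C(S'', S')) (s'' : S'') : ((D.comap f).comap g).toRat s'' = D.toRat (f (g s'')) := by
  rw [comap_toRat, comap_toRat]

/-! ## §2 The Hodge loci of `f* D` are the pulled-back Hodge loci -/

/-- **`Hdg-locus_{≤ K}(f* D) = f⁻¹(Hdg-locus_{≤ K}(D))`**: `s'` carries a nonzero integral Hodge class of level `p` and norm `≤ K` for `f* D` iff
`f s'` does for `D` (same fibre, same Hodge structure, same form). [cite: CattaniDeligneKaplan1995, §1 (p. 484) and «Proof of 1.5 ⟹ 1.1» (p. 485)] -/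
theorem hodgeLocusOfNormLe_comap (p K : ℤ) : (D.comap f).hodgeLocusOfNormLe p K = f ⁻¹' D.hodgeLocusOfNormLe p K := by
  ext s'
  simp only [mem_preimage, mem_hodgeLocusOfNormLe_iff, isHodgeAt_comap_iff, comap_toRat, comap_form]
  rfl

/-- Membership form: `s' ∈ Hdg-locus(f* D) ↔ f s' ∈ Hdg-locus(D)`. [cite: CattaniDeligneKaplan1995, §1 (p. 484)] -/
theorem mem_hodgeLocusOfNormLe_comap_iff (p K : ℤ) (s' : S') :
    s' ∈ (D.comap f).hodgeLocusOfNormLe p K ↔ f s' ∈ D.hodgeLocusOfNormLe p K := by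
  rw [hodgeLocusOfNormLe_comap, mem_preimage]

/-- **The determination locus pulls back INTO the pulled-back determination locus**: if some determination of `u₀` along a path class `γ'` of
`S'` from `s'₀` to `t'` is of type `(p, p)` for `f* D`, then the determination of `u₀` along `f ∘ γ'` is of type `(p, p)` for `D` at `f t'` (equality
of the two loci would need path lifting along `f`). [cite: CattaniDeligneKaplan1995, Cor. 1.3 (p. 484)] -/
theorem determinationLocus_comap_subset (p : ℤ) (s'₀ : S') (u₀ : D.VZ.fiber (f s'₀)) :
    {t' : S' | ∃ γ' : Path.Homotopic.Quotient s'₀ t', (D.comap f).IsHodgeAt t' p ((D.comap f).VZ.transport γ' u₀)} ⊆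
      f ⁻¹' {t : S | ∃ γ : Path.Homotopic.Quotient (f s'₀) t, D.IsHodgeAt t p (D.VZ.transport γ u₀)} := by
  rintro t' ⟨γ', h⟩
  exact ⟨γ'.map f, by rwa [isHodgeAt_comap_iff, comap_VZ_transport] at h⟩

/-! ## §3 Descent of «everything or finite» along a surjection («one is free to replace `S` by a finite etale covering `S' → S`») -/

/-- **Descent**: for `f : S' → S` continuous and SURJECTIVE, if the Hodge locus of norm `≤ K` of the pull-back `f* D` is all of `S'` or finite,
then the Hodge locus of norm `≤ K` of `D` is all of `S` or finite (`Z' = f⁻¹ Z`, so `Z = f(Z')`).  This is the reduction «To prove 1.1 one is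
free to replace `S` of 1.1 by a finite etale covering `S' → S`» read on the conclusion of Thm. 1.1 over a curve.
[cite: CattaniDeligneKaplan1995, «Proof of 1.5 ⟹ 1.1» (p. 485)] -/
theorem hodgeLocusOfNormLe_eq_univ_or_finite_of_comap (hf : Function.Surjective f) {p K : ℤ}
    (h : (D.comap f).hodgeLocusOfNormLe p K = univ ∨ ((D.comap f).hodgeLocusOfNormLe p K).Finite) :
    D.hodgeLocusOfNormLe p K = univ ∨ (D.hodgeLocusOfNormLe p K).Finite := by
  rw [hodgeLocusOfNormLe_comap] at h
  have himage : f '' (f ⁻¹' D.hodgeLocusOfNormLe p K) = D.hodgeLocusOfNormLe p K := image_preimage_eq _ hf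
  rcases h with huniv | hfin
  · refine Or.inl ?_
    rw [← himage, huniv, image_univ, hf.range_eq]
  · exact Or.inr (himage ▸ hfin.image f)

/-- **Pull-back**: for `f` with FINITE fibres (e.g. a finite covering), if the Hodge locus of norm `≤ K` of `D` is all of `S` or finite, so is that
of `f* D`. [cite: CattaniDeligneKaplan1995, «Proof of 1.5 ⟹ 1.1» (p. 485)] -/
theorem hodgeLocusOfNormLe_comap_eq_univ_or_finite (hf : ∀ s : S, (f ⁻¹' {s}).Finite) {p K : ℤ}
    (h : D.hodgeLocusOfNormLe p K = univ ∨ (D.hodgeLocusOfNormLe p K).Finite) :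
    (D.comap f).hodgeLocusOfNormLe p K = univ ∨ ((D.comap f).hodgeLocusOfNormLe p K).Finite := by
  rw [hodgeLocusOfNormLe_comap]
  rcases h with huniv | hfin
  · exact Or.inl (by rw [huniv, preimage_univ])
  · exact Or.inr (hfin.preimage' fun s _ => hf s)

/-- For a surjective `f` with finite fibres the two dichotomies are EQUIVALENT: `Hdg-locus_{≤ K}(D)` is everything or finite iff
`Hdg-locus_{≤ K}(f* D)` is. [cite: CattaniDeligneKaplan1995, «Proof of 1.5 ⟹ 1.1» (p. 485)] -/
theorem hodgeLocusOfNormLe_eq_univ_or_finite_iff_comap (hf : Function.Surjective f) (hf' : ∀ s : S, (f ⁻¹' {s}).Finite) (p K : ℤ) :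
    (D.hodgeLocusOfNormLe p K = univ ∨ (D.hodgeLocusOfNormLe p K).Finite) ↔
      ((D.comap f).hodgeLocusOfNormLe p K = univ ∨ ((D.comap f).hodgeLocusOfNormLe p K).Finite) :=
  ⟨D.hodgeLocusOfNormLe_comap_eq_univ_or_finite f hf', D.hodgeLocusOfNormLe_eq_univ_or_finite_of_comap f hf⟩

/-- The Hodge locus of `D` is the IMAGE of that of `f* D` when `f` is surjective. [cite: CattaniDeligneKaplan1995, «Proof of 1.5 ⟹ 1.1» (p. 485)] -/
theorem image_hodgeLocusOfNormLe_comap (hf : Function.Surjective f) (p K : ℤ) :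
    f '' (D.comap f).hodgeLocusOfNormLe p K = D.hodgeLocusOfNormLe p K := by
  rw [hodgeLocusOfNormLe_comap, image_preimage_eq _ hf]

/-- **Monodromy of the pull-back**: the monodromy representation of `f* D` at `s'` is that of `D` at `f s'` composed with `π₁(f)`; stated on a
loop `γ'` as transport along `f ∘ γ'`.  In particular if the local system of `D` has unipotent (resp. trivial mod `k`) monodromy along the image
loops, so does `f* D` — the use made of the finite étale cover in the printed proof. [cite: CattaniDeligneKaplan1995, «Proof of 1.5 ⟹ 1.1» (p. 485)]
[cite: Deligne1970, I.1] -/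
theorem comap_VZ_transport_loop {s' : S'} (γ' : Path.Homotopic.Quotient s' s') (u : D.VZ.fiber (f s')) :
    (D.comap f).VZ.transport γ' u = D.VZ.transport (γ'.map f) u := rfl

end VHSData

end Literature.AlgebraicGeometry.Motives

end
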